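import Summits.CriticalPhenomena.PercolationContinuityZ3.Theorems.PercNearOneGluingNoHeavyLowerTailKnQuestion8CoefficientwiseMirrorWeighted
import HarnessLib

/-!
# The CROSS row (x-advantage against z-advantage) for a pendant conditioning vertex

Support file (`--supports stmt-CriticalPhenomena-4575`, closed), prover `prim-cplus-coupling` (gen 28).  No definitions, no notations, no named
facts, no sorries; standard axioms.  Memo `prim-cplus-coupling/A5-COUPLING-gen28.md` §1 (CROSS / GRAND).

Setting as in …CoefficientwiseMirror: colourings `s : Finset ι` of a finite multigraph `ends : ι → Sym2 V`, `C_v(s) = openCluster (ends '' s) v`; the cluster pair of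
`x` is `X = (C_x s, C_x sᶜ)`, that of `z` is `Y = (C_z s, C_z sᶜ)`; mirror test functions `ψ, θ` are antisymmetric and monotone in the first argument.
CONJECTURE CROSS (gen 28; the cross terms of GRAND = the 2-colouring shadow of vdBHK Thm 1.5 ⊗ 1.5; it contains the antipodal rows aBHK / AMASTER of gens 22–24):
  `Σ_{s : z ∉ C_x s, z ∉ C_x sᶜ} ψ(X(s))·θ(Y(s)) ≤ 0`   ('the x-advantage and the z-advantage are obtuse').
Exact census: 0 violations on all graphs with ≤ 7 vertices and all hypergraphs with ≤ 5 vertices (memo §3).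
* `Coefficientwise.cross_pendant` — **CROSS for a pendant `z`** (edge `e₀ = {z,v}`): resolving the colour of `e₀`, both halves equal
  `Σ_{t ⊆ E∖e₀ : v ∉ C_x t} ψ(C_x t, C_x(E∖e₀∖t))·θ({z} ∪ C_v t, {z})`, and `θ({z} ∪ C_v t, {z}) ≥ 0` is a weight that is constant on the cells of `C_v`
  (`mirror_offCluster_weighted_nonpos_sub` of the companion file …CoefficientwiseMirrorWeighted).
[cite: KozmaNitzan2024, Questions 8–9 (§5.5 p. 36) (context: the Question-8 pocket covariance programme)]
-/

namespace Summit.CriticalPhenomena.PercolationContinuityZ3.Theorems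

open Finset Literature.Probability.Percolation

namespace Coefficientwise

variable {ι V : Type*} [DecidableEq ι]
variable [Fintype ι]

open Classical in
/-- **CROSS for a pendant conditioning vertex.**  If `z ≠ x` is a leaf (`e₀ = {z,v}` its only edge, `z ≠ v`) and `ψ, θ` are mirror test functions
(antisymmetric, monotone in the first argument), then
  `Σ_{s : z ∉ C_x s, z ∉ C_x sᶜ} ψ(C_x s, C_x sᶜ)·θ(C_z s, C_z sᶜ) ≤ 0`.
Proof: resolve the colour of `e₀`; with `e₀` red the constraint is `v ∉ C_x`, `C_z = {z} ∪ C_v` and `C_z(complement) = {z}`; the blue half is the swap image of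
the red half (both `ψ` and `θ` change sign); the red half is `mirror_offCluster_weighted_nonpos_sub` with `A = {v}` and the cell-constant weight
`θ({z} ∪ C_v t, {z}) ≥ 0`. [this work] -/
theorem cross_pendant (ends : ι → Sym2 V) {z v x : V} {e₀ : ι} (he₀ : ends e₀ = s(z, v))
    (hpend : ∀ i, z ∈ ends i → i = e₀) (hzx : z ≠ x) (hzv : z ≠ v) (ψ θ : Set V → Set V → ℝ)
    (hψa : ∀ a b, ψ a b = -ψ b a) (hψm : ∀ a a' b, a ⊆ a' → ψ a b ≤ ψ a' b)
    (hθa : ∀ a b, θ a b = -θ b a) (hθm : ∀ a a' b, a ⊆ a' → θ a b ≤ θ a' b) :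
    ∑ s ∈ univ.filter (fun s : Finset ι => z ∉ openCluster (ends '' (↑s : Set ι)) x ∧ z ∉ openCluster (ends '' (↑(sᶜ) : Set ι)) x),
      ψ (openCluster (ends '' (↑s : Set ι)) x) (openCluster (ends '' (↑(sᶜ) : Set ι)) x) *
        θ (openCluster (ends '' (↑s : Set ι)) z) (openCluster (ends '' (↑(sᶜ) : Set ι)) z) ≤ 0 := by
  set K : Finset ι → Set V := fun s => openCluster (ends '' (↑s : Set ι)) x with hK
  set Cz : Finset ι → Set V := fun s => openCluster (ends '' (↑s : Set ι)) z with hCz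
  set Cv : Finset ι → Set V := fun s => openCluster (ends '' (↑s : Set ι)) v with hCv
  set E' : Finset ι := univ.erase e₀ with hE'
  set Φ' : Finset ι → ℝ := fun t => ψ (K t) (K (E' \ t)) * θ (insert z (Cv t)) ({z} : Set V) with hΦ'
  change ∑ s ∈ univ.filter (fun s : Finset ι => z ∉ K s ∧ z ∉ K sᶜ), ψ (K s) (K sᶜ) * θ (Cz s) (Cz sᶜ) ≤ 0
  have he₀E' : e₀ ∉ E' := fun h => (Finset.mem_erase.mp h).1 rfl
  have huniv : (univ : Finset (Finset ι)) = (insert e₀ E').powerset := by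
    rw [hE', Finset.insert_erase (Finset.mem_univ e₀), Finset.powerset_univ]
  -- the weight is nonnegative
  have hθ0 : ∀ S : Set V, 0 ≤ θ (insert z S) ({z} : Set V) := by
    intro S
    have h0 : θ ({z} : Set V) ({z} : Set V) = 0 := by have := hθa {z} {z}; linarith
    have h1 : θ ({z} : Set V) ({z} : Set V) ≤ θ (insert z S) ({z} : Set V) :=
      hθm _ _ _ (by intro y hy; rw [Set.mem_singleton_iff] at hy; subst hy; exact Set.mem_insert _ _)
    linarith
  -- the half-sum on `G − e₀`
  have hbase : ∑ t ∈ E'.powerset.filter (fun t : Finset ι => v ∉ K t), Φ' t ≤ 0 := by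
    have := mirror_offCluster_weighted_nonpos_sub ends E' x ({v} : Set V) (fun S => θ (insert z S) ({z} : Set V)) hθ0 ψ hψa hψm
    simpa [hK, hΦ', hCv, mul_comm] using this
  have compl_of_sub : ∀ t, t ⊆ E' → tᶜ = insert e₀ (E' \ t) := by
    intro t ht
    ext i
    simp only [Finset.mem_compl, Finset.mem_insert, Finset.mem_sdiff, hE', Finset.mem_erase, Finset.mem_univ, and_true]
    constructor
    · intro hi
      by_cases hie : i = e₀
      · exact Or.inl hie
      · exact Or.inr ⟨hie, hi⟩
    · rintro (rfl | ⟨_, hi⟩)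
      · exact fun h => he₀E' (ht h)
      · exact hi
  have compl_insert_of_sub : ∀ t, t ⊆ E' → (insert e₀ t)ᶜ = E' \ t := by
    intro t ht
    ext i
    simp only [Finset.mem_compl, Finset.mem_insert, Finset.mem_sdiff, hE', Finset.mem_erase, Finset.mem_univ, and_true, not_or]
  have notin_of_sub : ∀ t, t ⊆ E' → e₀ ∉ t := fun t ht h => he₀E' (ht h)
  have notin_sdiff : ∀ t, e₀ ∉ E' \ t := fun t h => he₀E' (Finset.mem_sdiff.mp h).1
  rw [Finset.sum_filter, huniv, Finset.sum_powerset_insert he₀E']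
  have h1 : ∑ t ∈ E'.powerset, (if z ∉ K t ∧ z ∉ K tᶜ then ψ (K t) (K tᶜ) * θ (Cz t) (Cz tᶜ) else 0) =
      ∑ t ∈ E'.powerset, (if v ∉ K (E' \ t) then ψ (K t) (K (E' \ t)) * θ ({z} : Set V) (insert z (Cv (E' \ t))) else 0) := by
    refine Finset.sum_congr rfl fun t ht => ?_
    have hsub : t ⊆ E' := Finset.mem_powerset.mp ht
    have hzt : z ∉ K t := leaf_not_mem_openCluster ends hpend hzx (notin_of_sub t hsub)
    have hCzt : Cz t = ({z} : Set V) := openCluster_leaf_eq ends hpend (notin_of_sub t hsub)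
    rw [compl_of_sub t hsub]
    have hCzc : Cz (insert e₀ (E' \ t)) = insert z (Cv (E' \ t)) := openCluster_leaf_insert ends he₀ hpend hzv (notin_sdiff t)
    by_cases hv : v ∈ K (E' \ t)
    · have hz : z ∈ K (insert e₀ (E' \ t)) := (leaf_mem_openCluster_insert_iff ends he₀ hpend hzx hzv (notin_sdiff t)).mpr hv
      simp [hz, hv]
    · have hKc : K (insert e₀ (E' \ t)) = K (E' \ t) := openCluster_insert_pendant ends he₀ hpend hzx (notin_sdiff t) hv
      have hzc : z ∉ K (E' \ t) := leaf_not_mem_openCluster ends hpend hzx (notin_sdiff t)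
      rw [hKc, hCzt, hCzc]
      simp [hzt, hzc, hv]
  have h2 : ∑ t ∈ E'.powerset, (if z ∉ K (insert e₀ t) ∧ z ∉ K (insert e₀ t)ᶜ then
        ψ (K (insert e₀ t)) (K (insert e₀ t)ᶜ) * θ (Cz (insert e₀ t)) (Cz (insert e₀ t)ᶜ) else 0) =
      ∑ t ∈ E'.powerset, (if v ∉ K t then Φ' t else 0) := by
    refine Finset.sum_congr rfl fun t ht => ?_
    have hsub : t ⊆ E' := Finset.mem_powerset.mp ht
    rw [compl_insert_of_sub t hsub]
    have hzc : z ∉ K (E' \ t) := leaf_not_mem_openCluster ends hpend hzx (notin_sdiff t)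
    have hCzi : Cz (insert e₀ t) = insert z (Cv t) := openCluster_leaf_insert ends he₀ hpend hzv (notin_of_sub t hsub)
    have hCzc : Cz (E' \ t) = ({z} : Set V) := openCluster_leaf_eq ends hpend (notin_sdiff t)
    by_cases hv : v ∈ K t
    · have hz : z ∈ K (insert e₀ t) := (leaf_mem_openCluster_insert_iff ends he₀ hpend hzx hzv (notin_of_sub t hsub)).mpr hv
      simp [hz, hv]
    · have hKi : K (insert e₀ t) = K t := openCluster_insert_pendant ends he₀ hpend hzx (notin_of_sub t hsub) hv
      have hzt : z ∉ K t := leaf_not_mem_openCluster ends hpend hzx (notin_of_sub t hsub)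
      rw [hKi, hCzi, hCzc]
      simp [hzt, hzc, hv, hΦ']
  have h3 : ∑ t ∈ E'.powerset, (if v ∉ K (E' \ t) then ψ (K t) (K (E' \ t)) * θ ({z} : Set V) (insert z (Cv (E' \ t))) else 0) =
      ∑ t ∈ E'.powerset, (if v ∉ K t then Φ' t else 0) := by
    refine Finset.sum_bij' (fun t _ => E' \ t) (fun t _ => E' \ t) ?_ ?_ ?_ ?_ ?_
    · intro t _; exact Finset.mem_powerset.mpr Finset.sdiff_subset
    · intro t _; exact Finset.mem_powerset.mpr Finset.sdiff_subset
    · intro t ht; exact Finset.sdiff_sdiff_eq_self (Finset.mem_powerset.mp ht)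
    · intro t ht; exact Finset.sdiff_sdiff_eq_self (Finset.mem_powerset.mp ht)
    · intro t ht
      have hsub : t ⊆ E' := Finset.mem_powerset.mp ht
      simp only [hΦ', Finset.sdiff_sdiff_eq_self hsub]
      rw [hψa (K (E' \ t)) (K t), hθa ({z} : Set V) (insert z (Cv (E' \ t)))]
      by_cases hv : v ∈ K (E' \ t)
      · simp [hv]
      · simp [hv]
  rw [h1, h2, h3, ← Finset.sum_filter]
  linarith [hbase]


end Coefficientwise

end Summit.CriticalPhenomena.PercolationContinuityZ3.Theorems
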